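import Summits.ResolutionOfSingularities.ResolutionOfSingularities.Theorems.WeightedInvariantP3aTieFreeDrop
import Summits.ResolutionOfSingularities.ResolutionOfSingularities.Theorems.WeightedInvariantP3aSuccessorRsp
import Summits.ResolutionOfSingularities.ResolutionOfSingularities.Theorems.WeightedInvariantKWildHomDrop
import HarnessLib

/-!
# The PIN: a `t`-homogeneous successor on the tie locus is the generic point of its tie curve, a regular local threefold
# (door `HypersurfaceCentreConstruction`, stmt-ResolutionOfSingularities-19897; residual (D-b³-curve-FRAC-TIE) of `stub_keyRungGrHomLE_three`)

Topic: `Summits/ResolutionOfSingularities/ResolutionOfSingularities/Theorems`. Helper for the door item `HypersurfaceCentreConstruction`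
(stmt-ResolutionOfSingularities-19897, route `WeightedInvariant`), line `local-engine`, def-free.  Sequel of `…P3aTieLocus` (at a successor over the
special point of the P3a cylinder move `B = S[t⁻¹, 𝒥ₙ((y,x);(r,q)) tⁿ]` the order drops unless the successor lies on a tie curve
`Y - λX^r ∈ 𝔫 ∌ X`, `λ = 0` or `q = 1`, or (`q = r = 1`) `X ∈ 𝔫 ∌ Y`, with `f` in the corresponding tie ideal).  The (D-b³) conjunct reads
`t`-HOMOGENEOUS primes only (`IsTHomogeneous`, …KWildHomDrop; RULING #8); this file pins those down:
* `exists_coe_eq_single_of_isHomogeneousElem`, `mem_weightedMonomialIdeal_of_coe_eq`, `eq_algebraMap_mul_tInv_pow_of_coe_eq`,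
  `tInv_pow_mul_eq_algebraMap_of_coe_eq` — a `t`-homogeneous element of `B` is a Laurent monomial `a tᵈ`; `a ∈ 𝒥_d` and `(t⁻¹)ᵈ b = a`
  for `d ≥ 0`; `b = a (t⁻¹)^{-d}` for `d < 0`;
* **`face_mem_span_line`** — in `κ[X₀, X₁]` a weighted-homogeneous face form lying in a prime `P ∋ Xᵢ - μXⱼ^m ∌ Xⱼ` (`μ = 0` or
  `w_j m = w_i`) is a multiple of `Xᵢ - μXⱼ^m` (substitution `Xᵢ ↦ μX^m`, `Xⱼ ↦ X` of …P3aSuccessorRsp);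
* **`eq_span_triple_of_isTHomogeneous`** (chart form), **`…_of_tieCurve`**, **`…_of_X_mem`** — THE PIN: a `t`-homogeneous prime `𝔫 ∋ t⁻¹, z`
  with `W = Y - λX^r ∈ 𝔫 ∌ X` (resp. `X ∈ 𝔫 ∌ Y`) IS `(t⁻¹, z, W)` (resp. `(t⁻¹, z, X)`), the generic point of the tie curve;
* **`isRegularLocalRing_of_eq_span_triple`** — there `B_𝔫` is REGULAR LOCAL OF KRULL DIMENSION `3` with regular system of parameters
  `(t⁻¹, z, W)/1` (…P3aSuccessorRsp's `exists_rsp_of_mem` + Krull; the two loci are specialised in …Iota3DropCurveTieLocus).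
So (CURVE-TIE.md §4, sub-size (i) complete): at a tied curve centre the `t`-homogeneous successors over the closed point where the order letter
of `ι₃ᵗ` can persist are exactly the points `(t⁻¹, z, (y - λx^r)t^r)` with `f` in the tie ideal of `λ` (and `(t⁻¹, z, xt)` when `q = r = 1`),
regular local threefolds with residue field `κ(X)`; the `σ`-comparison there (ii) and the torus step (iii) remain.
[OURS · L1 W4.3 · (D-b³-curve-FRAC-TIE) sub-size (i)]  Replaces the role of NO printed item; NOT a statement of the manuscript under review
[claim: Hironaka2017, status: under-review]; candidates stay candidates; AI work, weaker than expert review.  No definition; no axiom.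

## References

* J. Włodarczyk, *Functorial resolution by torus actions*, arXiv:2203.03090, §2.3.9, §3.3. [Wlodarczyk2022]
* H. Matsumura, *Commutative Ring Theory* (1986), Thm. 13.4. [Matsumura1987]
-/

noncomputable section

open IsLocalRing Literature.AlgebraicGeometry.Resolution
open scoped LaurentPolynomial
open Summit.ResolutionOfSingularities.ResolutionOfSingularities.Cruxes.HypersurfaceCentreConstruction.LocalEngine

set_option linter.dupNamespace false -- mandated namespace of this single-conjunct summit

namespace Summit.ResolutionOfSingularities.ResolutionOfSingularities.Theorems

namespace LocalGameEFTCylinder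

section HomElem

variable {S : Type} [CommRing S] {d : ℕ} (u : Fin d → S) (w : Fin d → ℕ)

/-- A `t`-homogeneous element of the cobordant algebra is a Laurent monomial `a tᵐ`. [folklore] -/
theorem exists_coe_eq_single_of_isHomogeneousElem {b : extReesAlgebra (weightedMonomialIdeal u w)}
    (hb : SetLike.IsHomogeneousElem (KWildHom.tGrading u w) b) :
    ∃ (m : ℤ) (a : S), (b : S[T;T⁻¹]) = LaurentPolynomial.C a * LaurentPolynomial.T m := by
  obtain ⟨m, hm⟩ := hb
  rw [KWildHom.mem_tPiece_iff, AddMonoidAlgebra.mem_grade_iff] at hm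
  refine ⟨m, (b : S[T;T⁻¹]).coeff m, ?_⟩
  rw [← LaurentPolynomial.single_eq_C_mul_T]
  have h := Finsupp.support_subset_singleton.mp hm
  ext k
  rw [AddMonoidAlgebra.coeff_single]
  exact DFunLike.congr_fun h k

/-- The coefficient of a Laurent monomial `a tⁿ` (`n ≥ 0`) of the cobordant algebra lies in `𝒥ₙ`. [folklore] -/
theorem mem_weightedMonomialIdeal_of_coe_eq {b : extReesAlgebra (weightedMonomialIdeal u w)} {n : ℕ} {a : S}
    (hb : (b : S[T;T⁻¹]) = LaurentPolynomial.C a * LaurentPolynomial.T (n : ℤ)) :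
    a ∈ weightedMonomialIdeal u w n := by
  have h := b.2
  rw [hb, extReesAlgebra_weightedMonomialIdeal_eq_extendedRees, IdealFiltration.C_mul_T_mem_extendedRees_iff,
    ← weightedMonomialIdeal_eq_weightedFiltration_ideal] at h
  exact h

/-- A Laurent monomial `a t^{-n}` of the cobordant algebra is `a · (t⁻¹)ⁿ`. [folklore] -/
theorem eq_algebraMap_mul_tInv_pow_of_coe_eq {b : extReesAlgebra (weightedMonomialIdeal u w)} {n : ℕ} {a : S}
    (hb : (b : S[T;T⁻¹]) = LaurentPolynomial.C a * LaurentPolynomial.T (-(n : ℤ))) :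
    b = algebraMap S _ a * extReesAlgebra.tInv (weightedMonomialIdeal u w) ^ n := by
  apply Subtype.ext
  rw [hb, Subalgebra.coe_mul, Subalgebra.coe_pow, extReesAlgebra.coe_tInv, Subalgebra.coe_algebraMap,
    ← LaurentPolynomial.C_eq_algebraMap, LaurentPolynomial.T_pow]
  congr 2
  ring

/-- A Laurent monomial `a tⁿ` (`n ≥ 0`) of the cobordant algebra times `(t⁻¹)ⁿ` is `a`. [folklore] -/
theorem tInv_pow_mul_eq_algebraMap_of_coe_eq {b : extReesAlgebra (weightedMonomialIdeal u w)} {n : ℕ} {a : S}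
    (hb : (b : S[T;T⁻¹]) = LaurentPolynomial.C a * LaurentPolynomial.T (n : ℤ)) :
    extReesAlgebra.tInv (weightedMonomialIdeal u w) ^ n * b = algebraMap S _ a := by
  apply Subtype.ext
  rw [Subalgebra.coe_mul, Subalgebra.coe_pow, extReesAlgebra.coe_tInv, hb, Subalgebra.coe_algebraMap,
    ← LaurentPolynomial.C_eq_algebraMap, LaurentPolynomial.T_pow, mul_left_comm, ← LaurentPolynomial.T_add]
  rw [show ((n : ℤ) * -1 + (n : ℤ)) = 0 by ring, LaurentPolynomial.T_zero, mul_one]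

end HomElem

/-! ### Two-index bookkeeping -/

/-- For `i ≠ j` in `Fin 2`, a product over `Fin 2` is the product of the `i`-th and `j`-th factors. [folklore] -/
theorem prod_univ_two_of_ne {M : Type} [CommMonoid M] {i j : Fin 2} (hij : i ≠ j) (g : Fin 2 → M) :
    ∏ k, g k = g i * g j := by
  rw [Fin.prod_univ_two]
  fin_cases i <;> fin_cases j
  · exact absurd rfl hij
  · rfl
  · exact mul_comm _ _
  · exact absurd rfl hij

/-- For `i ≠ j` in `Fin 2`, a sum over `Fin 2` is the sum of the `i`-th and `j`-th terms. [folklore] -/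
theorem sum_univ_two_of_ne {M : Type} [AddCommMonoid M] {i j : Fin 2} (hij : i ≠ j) (g : Fin 2 → M) :
    ∑ k, g k = g i + g j := by
  rw [Fin.sum_univ_two]
  fin_cases i <;> fin_cases j
  · exact absurd rfl hij
  · rfl
  · exact add_comm _ _
  · exact absurd rfl hij

/-! ### A weighted-homogeneous face through a prime on the line `Xᵢ = μ Xⱼ^m` off `Xⱼ = 0` is a multiple of the line -/

section FaceLine

variable {κ : Type} [Field κ]

/-- **Face forms on a tie line.**  `κ` a field; `i ≠ j`; weights `wt` with `wt j > 0`; a face form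
`Φ = Σ_{α ∈ s} c_α X^α`, all `α ∈ s` of `wt`-weight `n`; a line `L = Xᵢ - μ Xⱼ^m` with `μ = 0` or `wt j · m = wt i` (so that `L` is
weighted-homogeneous or a coordinate); `P` a prime with `L ∈ P ∌ Xⱼ`.  Then `Φ ∈ P ⇒ Φ ∈ (L)`.  (Substitute `Xᵢ ↦ μX^m`, `Xⱼ ↦ X`
(`exists_killVar`): `Φ ↦ C · X^e`; the image of `P` is a prime of `κ[X]` not containing `X`, so `C = 0`.) [folklore] -/
theorem face_mem_span_line {i j : Fin 2} (hij : i ≠ j) (μ : κ) (m : ℕ) (wt : Fin 2 → ℕ) (hwj : 0 < wt j)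
    (hμ : μ = 0 ∨ wt j * m = wt i) (s : Finset (Fin 2 → ℕ)) (c : (Fin 2 → ℕ) → κ) {n : ℕ}
    (hs : ∀ α ∈ s, ∑ k, wt k * α k = n) (P : Ideal (MvPolynomial (Fin 2) κ)) [hP : P.IsPrime]
    (hL : MvPolynomial.X i - MvPolynomial.C μ * MvPolynomial.X j ^ m ∈ P) (hXj : MvPolynomial.X j ∉ P)
    (hΦ : ∑ α ∈ s, MvPolynomial.monomial (Finsupp.equivFunOnFinite.symm α) (c α) ∈ P) :
    ∑ α ∈ s, MvPolynomial.monomial (Finsupp.equivFunOnFinite.symm α) (c α) ∈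
      Ideal.span {MvPolynomial.X i - MvPolynomial.C μ * MvPolynomial.X j ^ m} := by
  classical
  obtain ⟨φ, hφs, hφker, hφj, hφi, hφC⟩ := exists_killVar i j hij μ m
  have hkerP : RingHom.ker φ ≤ P := by
    rw [hφker, Ideal.span_le, Set.singleton_subset_iff]; exact hL
  -- the image of each monomial
  set e₀ : ℕ := n / wt j with he₀
  have hmon : ∀ α ∈ s, φ (MvPolynomial.monomial (Finsupp.equivFunOnFinite.symm α) (c α)) =
      Polynomial.C (c α * μ ^ α i) * Polynomial.X ^ e₀ := by
    intro α hα
    have hprod : MvPolynomial.monomial (Finsupp.equivFunOnFinite.symm α) (c α) =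
        MvPolynomial.C (c α) * (MvPolynomial.X i ^ α i * MvPolynomial.X j ^ α j) := by
      rw [MvPolynomial.monomial_eq, Finsupp.prod_fintype _ _ (fun k => pow_zero _),
        ← prod_univ_two_of_ne hij (fun k => (MvPolynomial.X k : MvPolynomial (Fin 2) κ) ^ α k)]
      simp only [Finsupp.coe_equivFunOnFinite_symm]
    have h1 : φ (MvPolynomial.monomial (Finsupp.equivFunOnFinite.symm α) (c α)) =
        Polynomial.C (c α * μ ^ α i) * Polynomial.X ^ (m * α i + α j) := by
      rw [hprod, map_mul, map_mul, map_pow, map_pow, hφC, hφi, hφj, map_mul, map_pow, mul_pow, ← pow_mul, pow_add]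
      ring
    rw [h1]
    have hsα := hs α hα
    rw [sum_univ_two_of_ne hij] at hsα
    rcases hμ with rfl | hw
    · by_cases hαi : α i = 0
      · rw [hαi, mul_zero, zero_add, he₀]
        rw [hαi, mul_zero, zero_add] at hsα
        rw [← hsα, Nat.mul_div_cancel_left _ hwj]
      · rw [zero_pow hαi, mul_zero, map_zero, zero_mul, zero_mul]
    · have he : m * α i + α j = e₀ := by
        rw [he₀, ← hsα, ← hw]
        rw [show wt j * m * α i + wt j * α j = wt j * (m * α i + α j) by ring, Nat.mul_div_cancel_left _ hwj]
      rw [he]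
  have hφΦ : φ (∑ α ∈ s, MvPolynomial.monomial (Finsupp.equivFunOnFinite.symm α) (c α)) =
      Polynomial.C (∑ α ∈ s, c α * μ ^ α i) * Polynomial.X ^ e₀ := by
    rw [map_sum, map_sum, Finset.sum_mul]
    exact Finset.sum_congr rfl hmon
  -- the image prime
  haveI hQ : (P.map φ).IsPrime := Ideal.map_isPrime_of_surjective hφs hkerP
  have hXQ : Polynomial.X ∉ P.map φ := by
    intro h
    apply hXj
    have h2 : MvPolynomial.X j ∈ (P.map φ).comap φ := by rw [Ideal.mem_comap, hφj]; exact h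
    rw [Ideal.comap_map_of_surjective _ hφs] at h2
    rcases Submodule.mem_sup.mp h2 with ⟨a, ha, b, hb, hab⟩
    rw [← hab]
    exact P.add_mem ha (hkerP hb)
  have hCQ : Polynomial.C (∑ α ∈ s, c α * μ ^ α i) ∈ P.map φ := by
    have h := Ideal.mem_map_of_mem φ hΦ
    rw [hφΦ] at h
    rcases hQ.mem_or_mem h with h1 | h1
    · exact h1
    · exact absurd (hQ.mem_of_pow_mem _ h1) hXQ
  have hc0 : ∑ α ∈ s, c α * μ ^ α i = 0 := by
    by_contra hne
    exact hQ.ne_top (Ideal.eq_top_of_isUnit_mem _ hCQ (Polynomial.isUnit_C.mpr (Ne.isUnit hne)))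
  rw [← hφker, RingHom.mem_ker, hφΦ, hc0, map_zero, zero_mul]

end FaceLine

/-! ### The pin: `t`-homogeneity confines a tie-locus successor to the generic point of its tie curve -/

section Pin

variable {S : Type} [CommRing S] [IsRegularLocalRing S] {y x z : S} {r q : ℕ}

/-- **THE PIN LEMMA (chart form).**  `S` regular local with regular system of parameters `(y, x, z)`, weights `r, q ≥ 1` on `(y, x)`,
`B = S[t⁻¹, 𝒥ₙ((y,x);(r,q)) tⁿ]` with its special-fibre chart `ρ₀ : B ↠ κ[X₀, X₁]` (`ker ρ₀ = (t⁻¹, z)`, `ρ₀(uᵢ t^{wᵢ}) = Xᵢ`).  Let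
`𝔫 ∋ t⁻¹, z` be a `t`-HOMOGENEOUS prime containing an element `W` with `ρ₀ W = Xᵢ - μ Xⱼ^m` (`i ≠ j`; `μ = 0` or `w_j m = w_i`) and NOT
containing `u_j t^{w_j}`.  Then `𝔫 = (t⁻¹, z, W)` — the generic point of the tie curve `{W = 0}` of the special fibre.  (Every
homogeneous element of `𝔫` of `t`-degree `d ≥ 0` is the transform of its coefficient, whose face `ρ₀`-image is a weighted-homogeneous form in
`𝔫̄₀ = ρ₀(𝔫) ∌ Xⱼ`, hence a multiple of `ρ₀ W` (`face_mem_span_line`); degree `d < 0` elements are multiples of `t⁻¹`.)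
[OURS · L1 W4.3 · (D-b³-curve-FRAC-TIE) (i)] [cite: Wlodarczyk2022, §2.3.9] -/
theorem eq_span_triple_of_isTHomogeneous (hw : ∀ k, 0 < (![r, q] : Fin 2 → ℕ) k)
    {ρ₀ : extReesAlgebra (weightedMonomialIdeal ![y, x] ![r, q]) →+* MvPolynomial (Fin 2) (ResidueField S)}
    (hρ₀s : Function.Surjective ρ₀)
    (hρ₀ker : RingHom.ker ρ₀ = Ideal.span {extReesAlgebra.tInv (weightedMonomialIdeal ![y, x] ![r, q]),
      algebraMap S _ z})
    (hX : ∀ k, ρ₀ (LocalGameEFTPointMove.uT ![y, x] ![r, q] k) = MvPolynomial.X k)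
    (hC : ∀ a : S, ρ₀ (algebraMap S _ a) = MvPolynomial.C (residue S a))
    (hT0 : ρ₀ (extReesAlgebra.tInv (weightedMonomialIdeal ![y, x] ![r, q])) = 0)
    (𝔫 : Ideal (extReesAlgebra (weightedMonomialIdeal ![y, x] ![r, q]))) [𝔫.IsPrime]
    (hhom : IsTHomogeneous ![y, x] ![r, q] 𝔫)
    (hT : extReesAlgebra.tInv (weightedMonomialIdeal ![y, x] ![r, q]) ∈ 𝔫) (hz : algebraMap S _ z ∈ 𝔫)
    {i j : Fin 2} (hij : i ≠ j) {μ : ResidueField S} {m : ℕ} (hμ : μ = 0 ∨ (![r, q] : Fin 2 → ℕ) j * m = (![r, q] : Fin 2 → ℕ) i)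
    {W : extReesAlgebra (weightedMonomialIdeal ![y, x] ![r, q])}
    (hWρ : ρ₀ W = MvPolynomial.X i - MvPolynomial.C μ * MvPolynomial.X j ^ m) (hW : W ∈ 𝔫)
    (hXj : LocalGameEFTPointMove.uT ![y, x] ![r, q] j ∉ 𝔫) :
    𝔫 = Ideal.span {extReesAlgebra.tInv (weightedMonomialIdeal ![y, x] ![r, q]), algebraMap S _ z, W} := by
  classical
  haveI := isDomain_of_isRegularLocalRing S
  have hTne : extReesAlgebra.tInv (weightedMonomialIdeal ![y, x] ![r, q]) ≠ 0 :=
    nonZeroDivisors.ne_zero (tInv_mem_nonZeroDivisors _)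
  have hker𝔫 : RingHom.ker ρ₀ ≤ 𝔫 := ker_le_of_eq_span_pair ρ₀ hρ₀ker 𝔫 hT hz
  have hcomap : (Ideal.span {ρ₀ W}).comap ρ₀ =
      Ideal.span ({extReesAlgebra.tInv (weightedMonomialIdeal ![y, x] ![r, q]), algebraMap S _ z} ∪ {W}) :=
    comap_span_eq_of_surjective ρ₀ hρ₀s hρ₀ker (L := {W}) (by rw [Set.image_singleton])
  have hunion : ({extReesAlgebra.tInv (weightedMonomialIdeal ![y, x] ![r, q]), algebraMap S _ z} ∪ {W} :
      Set (extReesAlgebra (weightedMonomialIdeal ![y, x] ![r, q]))) =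
      {extReesAlgebra.tInv (weightedMonomialIdeal ![y, x] ![r, q]), algebraMap S _ z, W} := by
    ext b
    simp only [Set.mem_union, Set.mem_insert_iff, Set.mem_singleton_iff, or_assoc]
  haveI := map_isPrime_of_ker_le ρ₀ hρ₀s 𝔫 hker𝔫
  have h𝔫 : 𝔫 = (𝔫.map ρ₀).comap ρ₀ := (comap_map_eq_of_ker_le ρ₀ hρ₀s 𝔫 hker𝔫).symm
  have hXjbar : (MvPolynomial.X j : MvPolynomial (Fin 2) (ResidueField S)) ∉ 𝔫.map ρ₀ := fun h =>
    hXj (by rw [h𝔫, Ideal.mem_comap, hX]; exact h)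
  have hLbar : MvPolynomial.X i - MvPolynomial.C μ * MvPolynomial.X j ^ m ∈ 𝔫.map ρ₀ := by
    rw [← hWρ]; exact Ideal.mem_map_of_mem ρ₀ hW
  apply le_antisymm
  · rw [← hunion, ← hcomap]
    conv_lhs => rw [← hhom]
    rw [Ideal.span_le]
    rintro b ⟨hb𝔫, hbhom⟩
    rw [SetLike.mem_coe, Ideal.mem_comap]
    obtain ⟨d, a, hba⟩ := exists_coe_eq_single_of_isHomogeneousElem ![y, x] ![r, q] hbhom
    rcases le_or_gt 0 d with hd0 | hd0
    · -- `d = n ≥ 0`: `b` is the transform of `a ∈ 𝒥ₙ`, `ρ₀ b` is its face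
      obtain ⟨n, rfl⟩ := Int.eq_ofNat_of_zero_le hd0
      have ha : a ∈ weightedMonomialIdeal ![y, x] ![r, q] n := mem_weightedMonomialIdeal_of_coe_eq ![y, x] ![r, q] hba
      obtain ⟨l, hl, hal⟩ := exists_finsupp_of_mem_weightedMonomialIdeal ![y, x] ![r, q] ha
      obtain ⟨G, hG, hρG⟩ := exists_transform_of_finsupp ![y, x] ![r, q] (residue S) ρ₀ hX hC hT0 l hl hal
      have hbG : b = G :=
        mul_left_cancel₀ (pow_ne_zero n hTne) ((tInv_pow_mul_eq_algebraMap_of_coe_eq ![y, x] ![r, q] hba).trans hG)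
      rw [hbG, hρG, hWρ]
      refine face_mem_span_line hij μ m ![r, q] (hw j) hμ _ _ (fun α hα => (Finset.mem_filter.mp hα).2) (𝔫.map ρ₀)
        hLbar hXjbar ?_
      rw [← hρG, ← hbG]
      exact Ideal.mem_map_of_mem ρ₀ hb𝔫
    · -- `d < 0`: `b = a · (t⁻¹)^{-d}` is killed by `ρ₀`
      obtain ⟨n, hn⟩ := Int.exists_eq_neg_ofNat (le_of_lt hd0)
      have hn0 : n ≠ 0 := by rintro rfl; simp at hn; omega
      rw [hn] at hba
      rw [eq_algebraMap_mul_tInv_pow_of_coe_eq ![y, x] ![r, q] hba, map_mul, map_pow, hT0, zero_pow hn0, mul_zero]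
      exact Ideal.zero_mem _
  · rw [Ideal.span_le, Set.insert_subset_iff, Set.insert_subset_iff, Set.singleton_subset_iff]
    exact ⟨hT, hz, hW⟩

/-- Positivity of the weight vector `(r, q)`. [folklore] -/
theorem weights_pos (hq : 0 < q) (hqr : q ≤ r) : ∀ k, 0 < (![r, q] : Fin 2 → ℕ) k := by
  intro k; fin_cases k
  · exact lt_of_lt_of_le hq hqr
  · exact hq

/-- **THE PIN LEMMA on the tie curve `Y = λX^r`** (chart-free).  `S` regular local with regular system of parameters `(y, x, z)`
(`spanFinrank 𝔪 = 3`), weights `0 < q ≤ r` on `(y, x)`, `Y = y t^r`, `X = x t^q`, `W = Y - λX^r` with `λ = 0` or `q = 1`.  A `t`-HOMOGENEOUS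
prime `𝔫 ∋ t⁻¹, z, W` with `X ∉ 𝔫` IS `(t⁻¹, z, W)`. [OURS · L1 W4.3 · (D-b³-curve-FRAC-TIE) (i)] [cite: Wlodarczyk2022, §2.3.9] -/
theorem eq_span_triple_of_isTHomogeneous_of_tieCurve (hyxz : Ideal.span (Set.range ![y, x, z]) = maximalIdeal S)
    (hd : (maximalIdeal S).spanFinrank = 3) (hq : 0 < q) (hqr : q ≤ r)
    (𝔫 : Ideal (extReesAlgebra (weightedMonomialIdeal ![y, x] ![r, q]))) [𝔫.IsPrime]
    (hhom : IsTHomogeneous ![y, x] ![r, q] 𝔫)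
    (hT : extReesAlgebra.tInv (weightedMonomialIdeal ![y, x] ![r, q]) ∈ 𝔫) (hz : algebraMap S _ z ∈ 𝔫)
    {lam : S} (hlq : lam = 0 ∨ q = 1)
    (hW : LocalGameEFTPointMove.uT ![y, x] ![r, q] 0 -
      algebraMap S _ lam * LocalGameEFTPointMove.uT ![y, x] ![r, q] 1 ^ r ∈ 𝔫)
    (hXn : LocalGameEFTPointMove.uT ![y, x] ![r, q] 1 ∉ 𝔫) :
    𝔫 = Ideal.span {extReesAlgebra.tInv (weightedMonomialIdeal ![y, x] ![r, q]), algebraMap S _ z,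
      LocalGameEFTPointMove.uT ![y, x] ![r, q] 0 - algebraMap S _ lam * LocalGameEFTPointMove.uT ![y, x] ![r, q] 1 ^ r} := by
  have hw := weights_pos hq hqr
  obtain ⟨ρ₀, hρ₀s, hρ₀ker, hX, hC, hT0⟩ := exists_rhoZero hyxz hd ![r, q] hw
  have hμ : residue S lam = 0 ∨ (![r, q] : Fin 2 → ℕ) 1 * r = (![r, q] : Fin 2 → ℕ) 0 := by
    rcases hlq with rfl | rfl
    · exact Or.inl (map_zero _)
    · exact Or.inr (by simp)
  exact eq_span_triple_of_isTHomogeneous hw hρ₀s hρ₀ker hX hC hT0 𝔫 hhom hT hz Fin.zero_ne_one hμ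
    (by rw [map_sub, map_mul, map_pow, hX, hX, hC]) hW hXn

/-- **THE PIN LEMMA on the curve `X = 0`** (chart-free): a `t`-homogeneous prime `𝔫 ∋ t⁻¹, z, X` with `Y ∉ 𝔫` IS `(t⁻¹, z, X)`.
[OURS · L1 W4.3 · (D-b³-curve-FRAC-TIE) (i)] [cite: Wlodarczyk2022, §2.3.9] -/
theorem eq_span_triple_of_isTHomogeneous_of_X_mem (hyxz : Ideal.span (Set.range ![y, x, z]) = maximalIdeal S)
    (hd : (maximalIdeal S).spanFinrank = 3) (hq : 0 < q) (hqr : q ≤ r)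
    (𝔫 : Ideal (extReesAlgebra (weightedMonomialIdeal ![y, x] ![r, q]))) [𝔫.IsPrime]
    (hhom : IsTHomogeneous ![y, x] ![r, q] 𝔫)
    (hT : extReesAlgebra.tInv (weightedMonomialIdeal ![y, x] ![r, q]) ∈ 𝔫) (hz : algebraMap S _ z ∈ 𝔫)
    (hXmem : LocalGameEFTPointMove.uT ![y, x] ![r, q] 1 ∈ 𝔫) (hYn : LocalGameEFTPointMove.uT ![y, x] ![r, q] 0 ∉ 𝔫) :
    𝔫 = Ideal.span {extReesAlgebra.tInv (weightedMonomialIdeal ![y, x] ![r, q]), algebraMap S _ z,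
      LocalGameEFTPointMove.uT ![y, x] ![r, q] 1} := by
  have hw := weights_pos hq hqr
  obtain ⟨ρ₀, hρ₀s, hρ₀ker, hX, hC, hT0⟩ := exists_rhoZero hyxz hd ![r, q] hw
  have h10 : (1 : Fin 2) ≠ 0 := Fin.zero_ne_one.symm
  exact eq_span_triple_of_isTHomogeneous hw hρ₀s hρ₀ker hX hC hT0 𝔫 hhom hT hz h10 (μ := 0) (m := 0) (Or.inl rfl)
    (by rw [hX, map_zero, zero_mul, sub_zero]) hXmem hYn

/-- A triple has at most three elements. [folklore] -/
theorem ncard_triple_le {α : Type} (a b c : α) : ({a, b, c} : Set α).ncard ≤ 3 := by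
  refine (Set.ncard_insert_le a {b, c}).trans ?_
  have h := Set.ncard_insert_le b ({c} : Set α)
  rw [Set.ncard_singleton] at h
  omega

/-- **The pinned successor ring is a regular local THREEFOLD with regular system of parameters `(t⁻¹, z, W)`.**  Under the hypotheses of
`…P3aSuccessorRsp.exists_rsp_of_mem` (`W ∈ 𝔫 ∋ t⁻¹, z`, `ρ₀ W = Xᵢ - μXⱼ^r`), if moreover `𝔫 = (t⁻¹, z, W)` then `B_𝔫` is regular local of Krull
dimension `3` and `(t⁻¹, z, W)/1` generate its maximal ideal. [OURS · L1 W4.3 · (D-b³-curve-FRAC-TIE) (i)] [cite: Wlodarczyk2022, §2.3.9]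
[cite: Matsumura1987, Thm. 13.4] -/
theorem isRegularLocalRing_of_eq_span_triple (hyxz : Ideal.span (Set.range ![y, x, z]) = maximalIdeal S)
    (hd : (maximalIdeal S).spanFinrank = 3) [hP : (Ideal.span (Set.range ![y, x])).IsPrime] (hq : 0 < q) (hqr : q ≤ r)
    (𝔫 : Ideal (extReesAlgebra (weightedMonomialIdeal ![y, x] ![r, q]))) [𝔫.IsPrime]
    {W : extReesAlgebra (weightedMonomialIdeal ![y, x] ![r, q])} {i j : Fin 2} (hij : i ≠ j) {lam : S} {m : ℕ}
    (hWρ : ∀ (ρ₀ : extReesAlgebra (weightedMonomialIdeal ![y, x] ![r, q]) →+* MvPolynomial (Fin 2) (ResidueField S)),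
      (∀ k, ρ₀ (LocalGameEFTPointMove.uT ![y, x] ![r, q] k) = MvPolynomial.X k) →
      (∀ a : S, ρ₀ (algebraMap S _ a) = MvPolynomial.C (residue S a)) →
      ρ₀ W = MvPolynomial.X i - MvPolynomial.C (residue S lam) * MvPolynomial.X j ^ m)
    (h𝔫 : 𝔫 = Ideal.span {extReesAlgebra.tInv (weightedMonomialIdeal ![y, x] ![r, q]), algebraMap S _ z, W}) :
    IsRegularLocalRing (Localization.AtPrime 𝔫) ∧ ringKrullDim (Localization.AtPrime 𝔫) = (3 : ℕ) ∧
      Ideal.span {algebraMap _ (Localization.AtPrime 𝔫) (extReesAlgebra.tInv (weightedMonomialIdeal ![y, x] ![r, q])),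
        algebraMap _ (Localization.AtPrime 𝔫) (algebraMap S (extReesAlgebra (weightedMonomialIdeal ![y, x] ![r, q])) z),
        algebraMap _ (Localization.AtPrime 𝔫) W} =
        maximalIdeal (Localization.AtPrime 𝔫) := by
  have hw := weights_pos hq hqr
  have hzP : z ∉ Ideal.span (Set.range ![y, x]) := notMem_span_pair hyxz hd
  obtain ⟨ρ, -, hρker, -, hρC, -⟩ := LocalGameEFTPointMove.exists_rhoPartial ![y, x] ![r, q] hw
    (mem_maximalIdeal_pair hyxz) (linearIndependent_toCotangent_pair hyxz hd)
  obtain ⟨ρ₀, hρ₀s, hρ₀ker, hX, hC, -⟩ := exists_rhoZero hyxz hd ![r, q] hw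
  have hT : extReesAlgebra.tInv (weightedMonomialIdeal ![y, x] ![r, q]) ∈ 𝔫 :=
    h𝔫 ▸ Ideal.subset_span (Set.mem_insert _ _)
  have hz : algebraMap S _ z ∈ 𝔫 := h𝔫 ▸ Ideal.subset_span (Set.mem_insert_of_mem _ (Set.mem_insert _ _))
  have hW : W ∈ 𝔫 := h𝔫 ▸ Ideal.subset_span (Set.mem_insert_of_mem _ (Set.mem_insert_of_mem _ (Set.mem_singleton _)))
  obtain ⟨k, v, h0, h1, h2, hk4, -, -, -, -, hreg, hdim, -⟩ :=
    exists_rsp_of_mem hzP hρker hρC hρ₀s hρ₀ker (hW := hWρ ρ₀ hX hC) hij 𝔫 hT hz hW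
  haveI := isDomain_of_isRegularLocalRing S
  haveI : IsNoetherianRing (extReesAlgebra (weightedMonomialIdeal ![y, x] ![r, q])) :=
    isNoetherianRing_extReesAlgebra (stub_extReesAlgebra_weighted ![y, x] ![r, q])
  haveI : IsNoetherianRing (Localization.AtPrime 𝔫) :=
    IsLocalization.isNoetherianRing 𝔫.primeCompl (Localization.AtPrime 𝔫) inferInstance
  -- the maximal ideal is generated by the three images, so `dim ≤ 3`
  have h𝔪 : Ideal.span {algebraMap _ (Localization.AtPrime 𝔫) (extReesAlgebra.tInv (weightedMonomialIdeal ![y, x] ![r, q])),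
      algebraMap _ (Localization.AtPrime 𝔫) (algebraMap S (extReesAlgebra (weightedMonomialIdeal ![y, x] ![r, q])) z),
      algebraMap _ (Localization.AtPrime 𝔫) W} =
      maximalIdeal (Localization.AtPrime 𝔫) := by
    rw [← Localization.AtPrime.map_eq_maximalIdeal,
      congrArg (Ideal.map (algebraMap _ (Localization.AtPrime 𝔫))) h𝔫, Ideal.map_span, Set.image_insert_eq,
      Set.image_insert_eq, Set.image_singleton]
  have hfin : (maximalIdeal (Localization.AtPrime 𝔫)).spanFinrank ≤ 3 := by
    rw [← h𝔪]
    exact (Submodule.spanFinrank_span_le_ncard_of_finite (Set.toFinite _)).trans (ncard_triple_le _ _ _)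
  have hle := ringKrullDim_le_spanFinrank_maximalIdeal (Localization.AtPrime 𝔫)
  rw [hdim] at hle
  have hk3 : k = 3 := by
    have hk : ((k : ℕ∞) : WithBot ℕ∞) ≤ ((3 : ℕ) : ℕ∞) := hle.trans (by exact_mod_cast hfin)
    have hk' : k ≤ 3 := by exact_mod_cast hk
    omega
  subst hk3
  exact ⟨hreg, hdim, h𝔪⟩

end Pin

end LocalGameEFTCylinder

end Summit.ResolutionOfSingularities.ResolutionOfSingularities.Theorems

end
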